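import Summits.CriticalPhenomena.SAWScalingLimit.Theorems.SAWLoopFugacityFlowIsingBoundaryRatioWindowRectCycle
import Summits.CriticalPhenomena.SAWScalingLimit.Theorems.SAWLoopFugacityFlowIsingBoundaryRatioWindowRectFeet
import HarnessLib

/-!
# Window rectangle: probing the boundary cycle with feet
(line `fk-anchor-transfer`, crux `IsingBoundaryRatio`, stmt-CriticalPhenomena-10650; helper file of the stub
`windowRectPresentation_holds : WindowRectPresentation`)

In the static setting `X : WSetting`, four rough darts of the boundary cycle at cyclic positions
`a < b < c < e < a + N` whose boundary parameters are *unlinked with margin `m/2`* — `u_b` and `u_e` both lie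
at distance `≥ m/2` from the interval spanned by `u_a, u_c` — do not exist (`false_of_far`): the boundary
angles `θ(u) = π + 2 arctan u` of the feet are then `θ₀`-separated as required by the route separation field
`WSetting.hsep`, which draws outside routes from the foot of `a` to the foot of `c` and from the foot of `b`
to the foot of `e` at planar distance `≥ η > 2δ`, contradicting the feet theorem
`…WindowRectFeet.false_of_sep_routes`. Consequences recorded here: rough darts are **left** (`u < 0`) or
**right** (`u > 0`), and left and right darts do not interleave (`false_of_interleave_lr`). [folklore]
-/

noncomputable section

open scoped Classical Topology Real
open Filter Set Metric Complex
open Literature.Probability.LatticeModels Literature.Probability.RandomPlanarGeometry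
open Literature.Probability.LatticeModels.DiscreteRect Literature.Topology.PlaneTopology
open UpperHalfPlane (upperHalfPlaneSet)

namespace Summit.CriticalPhenomena.SAWScalingLimit.Theorems.IsingBoundaryRatio

namespace WindowRect

/-- The boundary angle `θ(u) = π + 2 arctan u` is continuous. [folklore] -/
theorem continuous_theta : Continuous fun u : ℝ => π + 2 * Real.arctan u := by fun_prop

/-- The boundary angle is monotone. [folklore] -/
theorem theta_le_theta {u v : ℝ} (h : u ≤ v) : π + 2 * Real.arctan u ≤ π + 2 * Real.arctan v := by
  have := Real.arctan_le_arctan_iff.2 h; linarith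

namespace WSetting

variable (X : WSetting)

/-- **From parameter gaps to angular margins.** If `q` is at distance `≥ m/2` from the interval spanned by
`ua, uc` (all of absolute value `≤ r₂ + m`), every angle between `θ(ua)` and `θ(uc)` is `θ₀`-far from `θ(q)`
(modulo `2π`). [folklore] -/
theorem angles_of_gap {ua uc q : ℝ} (hua : |ua| ≤ X.r₂ + X.m) (huc : |uc| ≤ X.r₂ + X.m) (hq : |q| ≤ X.r₂ + X.m)
    (hfar : q + X.m / 2 ≤ min ua uc ∨ max ua uc + X.m / 2 ≤ q) :
    ∀ θ ∈ uIcc (π + 2 * Real.arctan ua) (π + 2 * Real.arctan uc),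
      X.θ₀ ≤ |θ - (π + 2 * Real.arctan q)| ∧ |θ - (π + 2 * Real.arctan q)| ≤ 2 * π - X.θ₀ := by
  intro θ hθ
  obtain ⟨u', hu', rfl⟩ := intermediate_value_uIcc continuous_theta.continuousOn hθ
  have hab : min ua uc ≤ u' ∧ u' ≤ max ua uc := by
    rcases le_total ua uc with h | h
    · rw [uIcc_of_le h] at hu'; rw [min_eq_left h, max_eq_right h]; exact hu'
    · rw [uIcc_of_ge h] at hu'; rw [min_eq_right h, max_eq_left h]; exact hu'
  have hu'abs : |u'| ≤ X.r₂ + X.m := by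
    rw [abs_le] at hua huc ⊢
    constructor
    · exact le_trans (le_min hua.1 huc.1) hab.1
    · exact hab.2.trans (max_le hua.2 huc.2)
  have hgap : X.m / 2 ≤ |u' - q| := by
    have hm := X.hm
    rcases hfar with h | h
    · rw [abs_of_nonneg (by linarith [hab.1])]; linarith [hab.1]
    · rw [abs_of_nonpos (by linarith [hab.2])]; linarith [hab.2]
  exact X.hθ₀sep u' q hu'abs hq hgap

/-- **Four rough darts with unlinked feet do not exist.** [folklore] -/
theorem false_of_far {a b c e : ℕ} (hab : a < b) (hbc : b < c) (hce : c < e) (he : e < a + X.N)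
    (ha : a ∉ X.rim) (hb : b ∉ X.rim) (hc : c ∉ X.rim) (he' : e ∉ X.rim)
    (hfar : ∀ q, (q = X.u b ∨ q = X.u e) → q + X.m / 2 ≤ min (X.u a) (X.u c) ∨ max (X.u a) (X.u c) + X.m / 2 ≤ q) :
    False := by
  have HB : ∀ θ ∈ uIcc (π + 2 * Real.arctan (X.u a)) (π + 2 * Real.arctan (X.u c)), ∀ φ'',
      (φ'' = π + 2 * Real.arctan (X.u b) ∨ φ'' = π + 2 * Real.arctan (X.u e)) →
      X.θ₀ ≤ |θ - φ''| ∧ |θ - φ''| ≤ 2 * π - X.θ₀ := by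
    intro θ hθ φ'' hφ
    rcases hφ with rfl | rfl
    · exact X.angles_of_gap (X.abs_u_le ha) (X.abs_u_le hc) (X.abs_u_le hb) (hfar _ (Or.inl rfl)) θ hθ
    · exact X.angles_of_gap (X.abs_u_le ha) (X.abs_u_le hc) (X.abs_u_le he') (hfar _ (Or.inr rfl)) θ hθ
  have Hend : ∀ φ', (φ' = π + 2 * Real.arctan (X.u a) ∨ φ' = π + 2 * Real.arctan (X.u c)) → ∀ φ'',
      (φ'' = π + 2 * Real.arctan (X.u b) ∨ φ'' = π + 2 * Real.arctan (X.u e)) →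
      X.θ₀ ≤ |φ' - φ''| ∧ |φ' - φ''| ≤ 2 * π - X.θ₀ := by
    intro φ' hφ' φ'' hφ''
    rcases hφ' with rfl | rfl
    · exact HB _ left_mem_uIcc φ'' hφ''
    · exact HB _ right_mem_uIcc φ'' hφ''
  obtain ⟨A, B, hA, hB, hdist⟩ := X.hsep (X.foot a) (X.foot c) (X.foot b) (X.foot e) _ _ _ _
    (X.H_foot ha) (X.H_foot hc) (X.H_foot hb) (X.H_foot he') Hend HB
  have ec : (succ X.E)^[c - a] (X.dart a) = X.dart c := by rw [← X.dart_add]; congr 1; omega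
  have eb : (succ X.E)^[b - a] (X.dart a) = X.dart b := by rw [← X.dart_add]; congr 1; omega
  have ee : (succ X.E)^[e - a] (X.dart a) = X.dart e := by rw [← X.dart_add]; congr 1; omega
  refine false_of_sep_routes (D := X.D.toJordanDomain) X.hδ X.E_subset_zd X.E_connected
    (fun v w h => X.segment_subset_closure h) (X.dart_ext a) (X.iterate_inj a)
    (j := b - a) (l := c - a) (m := e - a) (by omega) (by omega) (by omega) (by omega)
    (X.foot_mem_segment ha) (by rw [ec]; exact X.foot_mem_segment hc) (by rw [eb]; exact X.foot_mem_segment hb)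
    (by rw [ee]; exact X.foot_mem_segment he')
    (X.foot_not_mem_segment ha) (X.foot_not_mem_segment hc) (X.foot_not_mem_segment hb) (X.foot_not_mem_segment he')
    A B hA hB fun z hz z' hz' => ?_
  linarith [hdist z hz z' hz', X.hδη]

/-! ### Left and right rough darts -/

/-- **Left rough positions**: `u < 0`. [folklore] -/
def lft : Set ℕ := {i | i ∉ X.rim ∧ X.u i < 0}

/-- **Right rough positions**: `u > 0`. [folklore] -/
def rgt : Set ℕ := {i | i ∉ X.rim ∧ 0 < X.u i}

/-- Membership in `lft`, unfolded. [folklore] -/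
theorem mem_lft_iff {i : ℕ} : i ∈ X.lft ↔ i ∉ X.rim ∧ X.u i < 0 := Iff.rfl
/-- Membership in `rgt`, unfolded. [folklore] -/
theorem mem_rgt_iff {i : ℕ} : i ∈ X.rgt ↔ i ∉ X.rim ∧ 0 < X.u i := Iff.rfl

/-- **The parameter of a rough dart is large**: `|u| ≥ w₁ - κ`. [folklore] -/
theorem le_abs_u {i : ℕ} (hi : i ∉ X.rim) : X.w₁ - X.κ ≤ |X.u i| := by
  have h := abs_le.1 (X.u_facts hi).1
  linarith [(X.site_rad i).1]

/-- A rough position is left or right. [folklore] -/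
theorem lft_or_rgt {i : ℕ} (hi : i ∉ X.rim) : i ∈ X.lft ∨ i ∈ X.rgt := by
  have h := X.le_abs_u hi
  have hpos : 0 < X.w₁ - X.κ := by
    obtain ⟨hm, hκ, hκm, hr₁, hw₁, -⟩ := X.radii'; linarith
  rcases lt_trichotomy (X.u i) 0 with h0 | h0 | h0
  · exact Or.inl ⟨hi, h0⟩
  · rw [h0, abs_zero] at h; linarith
  · exact Or.inr ⟨hi, h0⟩

/-- A left position has `u ≤ -(w₁ - κ)`. [folklore] -/
theorem u_le_of_lft {i : ℕ} (hi : i ∈ X.lft) : X.u i ≤ -(X.w₁ - X.κ) := by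
  have h := X.le_abs_u hi.1; rw [abs_of_neg hi.2] at h; linarith

/-- A right position has `w₁ - κ ≤ u`. [folklore] -/
theorem le_u_of_rgt {i : ℕ} (hi : i ∈ X.rgt) : X.w₁ - X.κ ≤ X.u i := by
  have h := X.le_abs_u hi.1; rwa [abs_of_pos hi.2] at h

/-- `lft`, `rgt` are `N`-periodic (the foot depends only on the dart). [folklore] -/
theorem u_add_N (i : ℕ) : X.u (i + X.N) = X.u i := by
  simp only [u, foot, footS, mem_rim_iff, site_def, farSite_def, dart_add_N]

/-- `rim` complement is periodic. [folklore] -/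
theorem not_rim_add_N {i : ℕ} : i + X.N ∉ X.rim ↔ i ∉ X.rim := by rw [X.mem_rim_add_N]

/-- `lft` is `N`-periodic. [folklore] -/
theorem mem_lft_add_N {i : ℕ} : i + X.N ∈ X.lft ↔ i ∈ X.lft := by
  rw [mem_lft_iff, mem_lft_iff, u_add_N, not_rim_add_N]

/-- `rgt` is `N`-periodic. [folklore] -/
theorem mem_rgt_add_N {i : ℕ} : i + X.N ∈ X.rgt ↔ i ∈ X.rgt := by
  rw [mem_rgt_iff, mem_rgt_iff, u_add_N, not_rim_add_N]

/-- **Left and right rough darts do not interleave** (left at `a, c`, right at `b, e`). [folklore] -/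
theorem false_of_interleave_lr {a b c e : ℕ} (hab : a < b) (hbc : b < c) (hce : c < e) (he : e < a + X.N)
    (ha : a ∈ X.lft) (hb : b ∈ X.rgt) (hc : c ∈ X.lft) (he' : e ∈ X.rgt) : False := by
  have hw : X.m / 2 ≤ X.w₁ - X.κ := by obtain ⟨hm, hκ, hκm, hr₁, hw₁, -⟩ := X.radii'; linarith
  have hm := X.hm
  refine X.false_of_far hab hbc hce he ha.1 hb.1 hc.1 he'.1 fun q hq => Or.inr ?_
  have hq' : X.w₁ - X.κ ≤ q := by rcases hq with rfl | rfl; exacts [X.le_u_of_rgt hb, X.le_u_of_rgt he']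
  have := X.u_le_of_lft ha; have := X.u_le_of_lft hc
  have hmax : max (X.u a) (X.u c) ≤ -(X.w₁ - X.κ) := max_le (by assumption) (by assumption)
  linarith

/-- **Left and right rough darts do not interleave** (right at `a, c`, left at `b, e`). [folklore] -/
theorem false_of_interleave_rl {a b c e : ℕ} (hab : a < b) (hbc : b < c) (hce : c < e) (he : e < a + X.N)
    (ha : a ∈ X.rgt) (hb : b ∈ X.lft) (hc : c ∈ X.rgt) (he' : e ∈ X.lft) : False := by
  have hw : X.m / 2 ≤ X.w₁ - X.κ := by obtain ⟨hm, hκ, hκm, hr₁, hw₁, -⟩ := X.radii'; linarith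
  have hm := X.hm
  refine X.false_of_far hab hbc hce he ha.1 hb.1 hc.1 he'.1 fun q hq => Or.inl ?_
  have hq' : q ≤ -(X.w₁ - X.κ) := by rcases hq with rfl | rfl; exacts [X.u_le_of_lft hb, X.u_le_of_lft he']
  have := X.le_u_of_rgt ha; have := X.le_u_of_rgt hc
  have hmin : X.w₁ - X.κ ≤ min (X.u a) (X.u c) := le_min (by assumption) (by assumption)
  linarith

end WSetting

end WindowRect

/-- **Left and right rough darts of the window edge set do not interleave along its boundary cycle**, closed
form (registered sub-goal of stmt-CriticalPhenomena-10650). [folklore] -/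
theorem windowRect_false_of_interleave_lr : ∀ (X : WindowRect.WSetting) {a b c e : ℕ}, a < b → b < c → c < e → e < a + X.N → a ∈ X.lft → b ∈ X.rgt → c ∈ X.lft → e ∈ X.rgt → False :=
  fun X _ _ _ _ hab hbc hce he ha hb hc he' => X.false_of_interleave_lr hab hbc hce he ha hb hc he'

end Summit.CriticalPhenomena.SAWScalingLimit.Theorems.IsingBoundaryRatio

end
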